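import Literature.AlgebraicTopology.Homotopy.StellarHAT
import Literature.AlgebraicTopology.SingularHomology.HomotopyAdditionHorn
import HarnessLib

/-!
# The alternating product of the faces of a singular simplex is trivial in `πₖ`

Topic `Literature/AlgebraicTopology/Homotopy`. Let `W : Δᵏ⁺¹ → X` send the codimension-two
skeleton of `Δᵏ⁺¹` (points with two vanishing barycentric coordinates) to `x₀`
(`SingularHomology.KillsTwoZero x₀ W`, `HomotopyAdditionHorn.lean`). Then every face
`W ∘ δᵢ : Δᵏ → X` is a based simplicial sphere (`KillsTwoZero.comp_stdFace`), and

* `CSphere.prod_toClass_hat_face`: **`∏ᵢ toClass (hat (W ∘ δᵢ)) ^ (-1)^i = 1` in `π_ k X x₀`**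
  (`k ≥ 2`).

This is the homotopy addition theorem in the form consumed by the Hurewicz theorem (Hatcher,
*Algebraic Topology* (2002), §4.2, proof of Thm. 4.32 via Lemma 4.36-type additivity; Bredon,
*Topology and Geometry* (1993), VII Thm. 9.5; Spanier, *Algebraic Topology* (1966), Ch. 7 §5,
Prop. 3). Proof: the zeroth face is deformed, through the straight-line homotopy
(`StdSimplex.segm`, `HomotopyAdditionHorn.lean`) to the parallel projection
`hornRetr 0` of `StdSimplexHorn.lean` (A. Hatcher's/Spanier's retraction of `Δᵏ⁺¹` onto the horn
`Λ₀`), into the sphere `skelProj W = W ∘ hornRetr 0 ∘ δ₀`, which is *stellar* with faces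
`W ∘ δ₁, …, W ∘ δ_{k+1}` (`isStellar_skelProj`); the stellar homotopy addition theorem
(`StellarHAT.lean`) gives `toClass (hat (W ∘ δ₀)) = ∏ⱼ toClass (hat (W ∘ δ_{j+1})) ^ (-1)^j`.
Everything is proved; `[folklore]`.

## References

* A. Hatcher, *Algebraic Topology*, CUP (2002), §4.1–4.2. [HatcherAT2002]
* G. E. Bredon, *Topology and Geometry*, GTM 139 (1993), Ch. VII, Thm. 9.5. [Bredon1993]
-/

noncomputable section

open Set Metric Topology unitInterval
open scoped Topology.Homotopy
open Literature.AlgebraicTopology.SingularHomology (StdSimplex stdFace hornRetr hornMin stdHorn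
  stdFace_apply_self stdFace_apply_succAbove hornRetr_apply_of_ne hornRetr_apply_self hornRetr_eq_self
  hornMin_le KillsTwoZero KillsTwoZero.comp_stdFace StdSimplex.segm StdSimplex.continuous_segm
  StdSimplex.segm_zero StdSimplex.segm_one StdSimplex.segm_self)

universe u

namespace Literature.AlgebraicTopology.Homotopy

variable {k : ℕ} {X : Type u} [TopologicalSpace X] {x₀ : X}

variable {W : C(StdSimplex (k + 1), X)}

/-- A face point with a vanishing coordinate lies in the opposite horn and is a skeleton point:
`W (δ₀ s) = x₀`. [folklore] -/
theorem stdFace_zero_mem_stdHorn {s : StdSimplex k} (hs : ∃ l, s l = 0) : stdFace 0 s ∈ stdHorn 0 := by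
  obtain ⟨l, hl⟩ := hs
  refine ⟨l.succ, Fin.succ_ne_zero l, ?_⟩
  rw [← Fin.succAbove_zero, stdFace_apply_succAbove]; exact hl

/-! ### The deformed zeroth face -/

/-- **The deformed zeroth face** `W ∘ hornRetr 0 ∘ δ₀ : Δᵏ → X`. [folklore] -/
def skelProj (W : C(StdSimplex (k + 1), X)) : C(StdSimplex k, X) :=
  (W.comp (hornRetr 0)).comp (stdFace 0)

/-- The straight-line family from the zeroth face to the deformed zeroth face: at parameter `c`
(clamped to `[0, 1]`) the point `(1 - c) δ₀ s + c · hornRetr 0 (δ₀ s)` (`StdSimplex.segm`).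
[folklore] -/
def skelFamily (W : C(StdSimplex (k + 1), X)) (c : ℝ) : C(StdSimplex k, X) :=
  ⟨fun s => W (StdSimplex.segm (projIcc 0 1 zero_le_one c) (stdFace 0 s) (hornRetr 0 (stdFace 0 s))),
    W.continuous.comp (StdSimplex.continuous_segm.comp (continuous_const.prodMk
      ((stdFace 0).continuous.prodMk ((hornRetr 0).continuous.comp (stdFace 0).continuous))))⟩

/-- The family is jointly continuous. [folklore] -/
theorem continuous_skelFamily (W : C(StdSimplex (k + 1), X)) :
    Continuous fun p : StdSimplex k × ℝ => skelFamily W p.2 p.1 :=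
  W.continuous.comp (StdSimplex.continuous_segm.comp
    (((continuous_projIcc (h := zero_le_one)).comp continuous_snd).prodMk
      (((stdFace 0).continuous.comp continuous_fst).prodMk
        ((hornRetr 0).continuous.comp ((stdFace 0).continuous.comp continuous_fst)))))

/-- At `c = 0` the family is the zeroth face. [folklore] -/
theorem skelFamily_zero (W : C(StdSimplex (k + 1), X)) : skelFamily W 0 = W.comp (stdFace 0) := by
  ext s
  show W (StdSimplex.segm (projIcc 0 1 zero_le_one 0) _ _) = W (stdFace 0 s)
  rw [projIcc_left, Icc.mk_zero, StdSimplex.segm_zero]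

/-- At `c = 1` the family is the deformed zeroth face. [folklore] -/
theorem skelFamily_one (W : C(StdSimplex (k + 1), X)) : skelFamily W 1 = skelProj W := by
  ext s
  show W (StdSimplex.segm (projIcc 0 1 zero_le_one 1) _ _) = W (hornRetr 0 (stdFace 0 s))
  rw [projIcc_right, Icc.mk_one, StdSimplex.segm_one]

/-- Each member of the family is based (on the horn the segment is constant). [folklore] -/
theorem isBased_skelFamily (hW : KillsTwoZero x₀ W) (c : ℝ) : IsBased x₀ (skelFamily W c) := by
  rintro s hs
  show W (StdSimplex.segm _ (stdFace 0 s) (hornRetr 0 (stdFace 0 s))) = x₀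
  rw [hornRetr_eq_self (stdFace_zero_mem_stdHorn hs), StdSimplex.segm_self]
  exact hW.comp_stdFace 0 s hs

/-- The deformed zeroth face is based. [folklore] -/
theorem isBased_skelProj (hW : KillsTwoZero x₀ W) : IsBased x₀ (skelProj W) :=
  skelFamily_one W ▸ isBased_skelFamily hW 1

namespace CSphere

/-- Hats of equal maps have equal classes (the basedness proofs are irrelevant). [folklore] -/
theorem toClass_hat_congr {g g' : C(stdSimplex ℝ (Fin (k + 1)), X)} (h : g = g') {hg : IsBased x₀ g}
    {hg' : IsBased x₀ g'} : (hat g hg).toClass = (hat g' hg').toClass := by subst h; rfl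

/-- **The zeroth face and the deformed zeroth face have the same class.** [folklore] -/
theorem toClass_hat_face_zero_eq_skelProj (hW : KillsTwoZero x₀ W) :
    (hat (W.comp (stdFace 0)) (hW.comp_stdFace 0)).toClass = (hat (skelProj W) (isBased_skelProj hW)).toClass :=
  (toClass_hat_congr (skelFamily_zero W).symm).trans
    (((hat_homotopic (skelFamily W) (continuous_skelFamily W) (isBased_skelFamily hW)).toClass_eq).trans
      (toClass_hat_congr (skelFamily_one W)))

end CSphere

/-! ### The deformed zeroth face is stellar -/

/-- On the region `{νⱼ minimal}`, the distance of `δ₀ ν` to the horn `Λ₀` is `νⱼ`. [folklore] -/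
theorem hornMin_stdFace_zero (ν : StdSimplex k) (j : Fin (k + 1)) (h : ∀ l, ν j ≤ ν l) :
    hornMin 0 (stdFace 0 ν) = ν j := by
  refine le_antisymm ?_ ?_
  · have := hornMin_le (j := 0) (i := j.succ) (Fin.succ_ne_zero j) (stdFace 0 ν)
    rwa [← Fin.succAbove_zero, stdFace_apply_succAbove] at this
  · refine Finset.le_inf' _ _ fun i hi => ?_
    obtain ⟨m, rfl⟩ := Fin.exists_succ_eq.2 (Finset.mem_erase.1 hi).1
    rw [← Fin.succAbove_zero, stdFace_apply_succAbove]
    exact h m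

/-- **The parallel projection of `δ₀ ν` is the face `δ_{j+1}` of the stellar point**, on the
region `{νⱼ minimal}`. [folklore] -/
theorem hornRetr_stdFace_zero (ν : StdSimplex k) (j : Fin (k + 1)) (h : ∀ l, ν j ≤ ν l) :
    hornRetr 0 (stdFace 0 ν) = stdFace j.succ (stellarPt j ν h) := by
  have hμ := hornMin_stdFace_zero ν j h
  apply stdSimplex.ext
  funext l
  refine Fin.cases ?_ (fun m => ?_) l
  · rw [hornRetr_apply_self, hμ, stdFace_apply_self,
      ← Fin.succAbove_ne_zero_zero (Fin.succ_ne_zero j), stdFace_apply_succAbove]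
    show 0 + ((k : ℝ) + 1) * ν j = stellarFun j ν 0
    rw [stellarFun_zero]; ring
  · rw [hornRetr_apply_of_ne (Fin.succ_ne_zero m), hμ, ← Fin.succAbove_zero, stdFace_apply_succAbove,
      Fin.succAbove_zero]
    by_cases hm : m = j
    · subst hm
      rw [stdFace_apply_self]
      show ν m - ν m = 0
      rw [sub_self]
    · obtain ⟨m', rfl⟩ := Fin.exists_succAbove_eq hm
      rw [← Fin.succ_succAbove_succ, stdFace_apply_succAbove]
      show ν (j.succAbove m') - ν j = stellarFun j ν m'.succ
      rw [stellarFun_succ]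

/-- **The deformed zeroth face is stellar with faces `W ∘ δ₁, …, W ∘ δ_{k+1}`.** [folklore] -/
theorem isStellar_skelProj (W : C(StdSimplex (k + 1), X)) :
    IsStellar (skelProj W) fun j => W.comp (stdFace j.succ) := by
  intro ν j h
  show W (hornRetr 0 (stdFace 0 ν)) = W (stdFace j.succ (stellarPt j ν h))
  rw [hornRetr_stdFace_zero ν j h]

namespace CSphere

/-- **The alternating product of the classes of the faces of a skeleton-based simplex is
trivial** (`k ≥ 2`): `∏ᵢ toClass (hat (W ∘ δᵢ)) ^ (-1)^i = 1` in `π_ k X x₀`. [folklore] -/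
theorem prod_toClass_hat_face [NeZero k] [Nontrivial (Fin k)] (hW : KillsTwoZero x₀ W) :
    ∏ i : Fin (k + 2), (hat (W.comp (stdFace i)) (hW.comp_stdFace i)).toClass ^ ((-1 : ℤ) ^ (i : ℕ)) = 1 := by
  have hstel := toClass_hat_stellar (isBased_skelProj hW) (fun j => hW.comp_stdFace j.succ)
    (isStellar_skelProj W)
  rw [← toClass_hat_face_zero_eq_skelProj hW] at hstel
  rw [Fin.prod_univ_succ]
  simp only [Fin.val_zero, pow_zero, zpow_one, Fin.val_succ, pow_succ, mul_neg, mul_one, zpow_neg]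
  rw [hstel, ← Finset.prod_mul_distrib]
  exact Finset.prod_eq_one fun j _ => mul_inv_cancel _

end CSphere

end Literature.AlgebraicTopology.Homotopy

end
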